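import Summits.Ventures.HodgeRepro2.T5BergmanHilbertSpace

/-!
# The weighted Bergman space is stable under the action; continuity in the group variable

For the weight-`k` action `(π_k(g) f)(z) = j(g⁻¹, z)^{-k} f(g⁻¹·z)` of `SU(1,1)` on the disc
(`T5BergmanCoefficient.act`) this file records the elementary stability facts the `L²`-theory of the
matrix coefficients `g ↦ ⟨π_k(g) f, h⟩_k` needs:

* `π_k(g) f` is continuous / holomorphic on `𝔻` when `f` is (`continuousOn_act`, `differentiableOn_act`);
* `A_k` is `π_k(g)`-stable: `|π_k(g) f|² (1 - |z|²)^{k-2}` is integrable on `𝔻` for holomorphic `f ∈ A_k`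
  (`integrableOn_act`; from unitarity `pairing_act_act` and positive-definiteness);
* **Cauchy–Schwarz for the matrix coefficients**: `|⟨π_k(g) f, h⟩_k|² ≤ ⟨f, f⟩_k ⟨h, h⟩_k`
  (`norm_pairing_act_sq_le`);
* the automorphy factor is bounded on the closed disc, `|j(g⁻¹, z)|^{-k} ≤ (2|a|)^k` for `g = su11 a b`
  (`norm_denom_inv_pow_le`), so `|π_k(g) f| ≤ (2|a|)^k sup |f|` for bounded `f` (`norm_act_le`);
* for fixed `z ∈ 𝔻` the map `g ↦ (π_k(g) f)(z)` is continuous on `SU(1,1)` (`continuous_act_left`);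
* pointwise linearity of `π_k(g)` in `f` (`act_add`, `act_sub`, `act_const_mul`, `act_sum`).

Blind lane: Mathlib + the HodgeRepro2 prefix only; no sorry; axioms ⊆ {propext, Classical.choice,
Quot.sound}.
-/

namespace Summit.Ventures.HodgeRepro2.T5BergmanActStable

open MeasureTheory MeasureTheory.Measure Metric Filter Topology
open T5PoincareDensity T5SU11Unimodular T5SU11Fibration
open T5BergmanCoefficient T5BergmanPairing T5BergmanUnitary T5BergmanFourier T5BergmanKernel
  T5BergmanParseval T5BergmanPointwise
open scoped Real

/-! ### The matrix entries -/

/-- `a ≠ 0` for `g = su11 a b` (`|a|² = 1 + |b|²`). -/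
lemma mat_zero_zero_ne_zero (g : SU11) : mat g 0 0 ≠ 0 := by
  intro h
  have := normSq_sub_normSq g
  rw [show ((g : Matrix.SpecialLinearGroup (Fin 2) ℂ) : Matrix (Fin 2) (Fin 2) ℂ) 0 0 = mat g 0 0
    from rfl, h, map_zero] at this
  linarith [Complex.normSq_nonneg (mat g 0 1)]

/-- `|a|² - |b|² = 1` for `g = su11 a b`, in norms. -/
lemma norm_sq_sub_norm_sq (g : SU11) : ‖mat g 0 0‖ ^ 2 - ‖mat g 0 1‖ ^ 2 = 1 := by
  have h := normSq_sub_normSq g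
  rw [Complex.normSq_eq_norm_sq, Complex.normSq_eq_norm_sq] at h
  exact h

/-- `|b| ≤ |a|` for `g = su11 a b`. -/
lemma norm_mat_zero_one_le (g : SU11) : ‖mat g 0 1‖ ≤ ‖mat g 0 0‖ := by
  have h := norm_sq_sub_norm_sq g
  by_contra hc
  have hc' := not_le.mp hc
  nlinarith [norm_nonneg (mat g 0 0), norm_nonneg (mat g 0 1)]

/-- `a ↦ mat g 0 0` is continuous on `SU(1,1)`. -/
lemma continuous_mat00 : Continuous fun g : SU11 => mat g 0 0 :=
  (continuous_apply 0).comp ((continuous_apply 0).comp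
    (continuous_subtype_val.comp continuous_subtype_val))

/-- `b ↦ mat g 0 1` is continuous on `SU(1,1)`. -/
lemma continuous_mat01 : Continuous fun g : SU11 => mat g 0 1 :=
  (continuous_apply 1).comp ((continuous_apply 0).comp
    (continuous_subtype_val.comp continuous_subtype_val))

/-- The `(0,0)` entry of `g⁻¹` is `ā`. -/
lemma mat_inv_zero_zero (g : SU11) : mat g⁻¹ 0 0 = (starRingEnd ℂ) (mat g 0 0) := by
  rw [mat_inv]
  simp [su11]

/-- The `(0,1)` entry of `g⁻¹` is `-b`. -/
lemma mat_inv_zero_one (g : SU11) : mat g⁻¹ 0 1 = -(mat g 0 1) := by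
  rw [mat_inv]
  simp [su11]

/-! ### The automorphy factor on the closed disc -/

/-- `|j(g⁻¹, z)| = |a - b̄ z| ≥ |a| - |b| = 1/(|a| + |b|) ≥ 1/(2|a|)` on the closed disc. -/
lemma norm_denom_inv_ge (g : SU11) {z : ℂ} (hz : z ∈ closedBall (0 : ℂ) 1) :
    (2 * ‖mat g 0 0‖)⁻¹ ≤ ‖denom (mat g⁻¹) z‖ := by
  rw [denom_inv_eq]
  have ha : 0 < ‖mat g 0 0‖ := norm_pos_iff.mpr (mat_zero_zero_ne_zero g)
  have hb := norm_mat_zero_one_le g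
  have hz1 : ‖z‖ ≤ 1 := mem_closedBall_zero_iff.mp hz
  have h := norm_sq_sub_norm_sq g
  have h1 : ‖mat g 0 0‖ - ‖(starRingEnd ℂ) (mat g 0 1) * z‖ ≤
      ‖mat g 0 0 - (starRingEnd ℂ) (mat g 0 1) * z‖ := norm_sub_norm_le _ _
  have h2 : ‖(starRingEnd ℂ) (mat g 0 1) * z‖ ≤ ‖mat g 0 1‖ := by
    rw [norm_mul, Complex.norm_conj]
    exact mul_le_of_le_one_right (norm_nonneg _) hz1
  have h3 : 1 ≤ (‖mat g 0 0‖ - ‖mat g 0 1‖) * (2 * ‖mat g 0 0‖) := by nlinarith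
  have hpos : 0 < 2 * ‖mat g 0 0‖ := by positivity
  calc (2 * ‖mat g 0 0‖)⁻¹ = (2 * ‖mat g 0 0‖)⁻¹ * 1 := (mul_one _).symm
    _ ≤ (2 * ‖mat g 0 0‖)⁻¹ * ((‖mat g 0 0‖ - ‖mat g 0 1‖) * (2 * ‖mat g 0 0‖)) :=
        mul_le_mul_of_nonneg_left h3 (by positivity)
    _ = ‖mat g 0 0‖ - ‖mat g 0 1‖ := by field_simp
    _ ≤ ‖mat g 0 0 - (starRingEnd ℂ) (mat g 0 1) * z‖ := by linarith

/-- `|j(g⁻¹, z)^{-k}| ≤ (2|a|)^k` on the closed disc. -/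
theorem norm_denom_inv_pow_le (g : SU11) (k : ℕ) {z : ℂ} (hz : z ∈ closedBall (0 : ℂ) 1) :
    ‖(denom (mat g⁻¹) z)⁻¹ ^ k‖ ≤ (2 * ‖mat g 0 0‖) ^ k := by
  rw [norm_pow, norm_inv]
  have hd : 0 < ‖denom (mat g⁻¹) z‖ := norm_pos_iff.mpr (denom_inv_ne_zero g hz)
  have ha : 0 < 2 * ‖mat g 0 0‖ := by
    have := norm_pos_iff.mpr (mat_zero_zero_ne_zero g)
    positivity
  refine pow_le_pow_left₀ (by positivity) ?_ k
  rw [inv_le_comm₀ hd ha]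
  exact norm_denom_inv_ge g hz

/-- `|(π_k(g) f)(z)| ≤ (2|a|)^k · M` on the disc when `|f| ≤ M` on the disc. -/
theorem norm_act_le (k : ℕ) (g : SU11) (f : ℂ → ℂ) {M : ℝ} (hM : ∀ w ∈ ball (0 : ℂ) 1, ‖f w‖ ≤ M)
    {z : ℂ} (hz : z ∈ ball (0 : ℂ) 1) : ‖act k g f z‖ ≤ (2 * ‖mat g 0 0‖) ^ k * M := by
  unfold act
  rw [norm_mul]
  exact mul_le_mul (norm_denom_inv_pow_le g k (ball_subset_closedBall hz))
    (hM _ (mobius_mem_ball g⁻¹ hz)) (norm_nonneg _) (by positivity)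

/-! ### Pointwise linearity in `f` -/

/-- `π_k(g)(f₁ + f₂) = π_k(g) f₁ + π_k(g) f₂` pointwise. -/
theorem act_add (k : ℕ) (g : SU11) (f₁ f₂ : ℂ → ℂ) (z : ℂ) :
    act k g (f₁ + f₂) z = act k g f₁ z + act k g f₂ z := by
  unfold act
  simp only [Pi.add_apply]
  ring

/-- `π_k(g)(f₁ - f₂) = π_k(g) f₁ - π_k(g) f₂` pointwise. -/
theorem act_sub (k : ℕ) (g : SU11) (f₁ f₂ : ℂ → ℂ) (z : ℂ) :
    act k g (f₁ - f₂) z = act k g f₁ z - act k g f₂ z := by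
  unfold act
  simp only [Pi.sub_apply]
  ring

/-- `π_k(g)(c f) = c · π_k(g) f` pointwise. -/
theorem act_const_mul (k : ℕ) (g : SU11) (c : ℂ) (f : ℂ → ℂ) (z : ℂ) :
    act k g (fun w => c * f w) z = c * act k g f z := by
  unfold act
  ring

/-- `π_k(g)` of a finite sum, pointwise. -/
theorem act_sum (k : ℕ) (g : SU11) {ι : Type*} (s : Finset ι) (F : ι → ℂ → ℂ) (z : ℂ) :
    act k g (fun w => ∑ i ∈ s, F i w) z = ∑ i ∈ s, act k g (F i) z := by
  unfold act
  rw [Finset.mul_sum]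

/-! ### Continuity and holomorphy of `π_k(g) f` on the disc -/

/-- `z ↦ j(g⁻¹, z)` is continuous. -/
lemma continuous_denom_inv_right (g : SU11) : Continuous fun z : ℂ => denom (mat g⁻¹) z := by
  simp_rw [denom_inv_eq]
  fun_prop

/-- `z ↦ j(g⁻¹, z)` is entire. -/
lemma differentiable_denom_inv_right (g : SU11) :
    Differentiable ℂ fun z : ℂ => denom (mat g⁻¹) z := by
  simp_rw [denom_inv_eq]
  fun_prop

/-- The Möbius map `z ↦ g⁻¹·z` as a quotient of affine functions. -/
lemma mobius_inv_eq (g : SU11) (z : ℂ) :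
    mobius (mat g⁻¹) z =
      ((starRingEnd ℂ) (mat g 0 0) * z + -(mat g 0 1)) / denom (mat g⁻¹) z := by
  rw [mobius_eq, mat_inv_zero_zero, mat_inv_zero_one]

/-- `z ↦ g⁻¹·z` is continuous on the disc. -/
lemma continuousOn_mobius_inv (g : SU11) :
    ContinuousOn (fun z : ℂ => mobius (mat g⁻¹) z) (ball 0 1) := by
  simp_rw [mobius_inv_eq]
  exact ((continuous_const.mul continuous_id).add continuous_const).continuousOn.div
    (continuous_denom_inv_right g).continuousOn
    (fun z hz => denom_inv_ne_zero g (ball_subset_closedBall hz))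

/-- `z ↦ g⁻¹·z` is holomorphic on the disc. -/
lemma differentiableOn_mobius_inv (g : SU11) :
    DifferentiableOn ℂ (fun z : ℂ => mobius (mat g⁻¹) z) (ball 0 1) := by
  simp_rw [mobius_inv_eq]
  exact (((differentiable_const _).mul differentiable_id).add
    (differentiable_const _)).differentiableOn.div
    (differentiable_denom_inv_right g).differentiableOn
    (fun z hz => denom_inv_ne_zero g (ball_subset_closedBall hz))

/-- **`π_k(g) f` is continuous on the disc** when `f` is. -/
theorem continuousOn_act (k : ℕ) (g : SU11) (f : ℂ → ℂ) (hf : ContinuousOn f (ball 0 1)) :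
    ContinuousOn (act k g f) (ball 0 1) := by
  unfold act
  refine (((continuous_denom_inv_right g).continuousOn.inv₀
    (fun z hz => denom_inv_ne_zero g (ball_subset_closedBall hz))).pow k).mul
    (hf.comp (continuousOn_mobius_inv g) ?_)
  intro z hz
  exact mobius_mem_ball g⁻¹ hz

/-- **`π_k(g) f` is holomorphic on the disc** when `f` is. -/
theorem differentiableOn_act (k : ℕ) (g : SU11) (f : ℂ → ℂ)
    (hf : DifferentiableOn ℂ f (ball 0 1)) : DifferentiableOn ℂ (act k g f) (ball 0 1) := by
  unfold act
  refine (((differentiable_denom_inv_right g).differentiableOn.inv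
    (fun z hz => denom_inv_ne_zero g (ball_subset_closedBall hz))).pow k).mul
    (hf.comp (differentiableOn_mobius_inv g) ?_)
  intro z hz
  exact mobius_mem_ball g⁻¹ hz

/-! ### Continuity in the group variable -/

/-- `g ↦ j(g⁻¹, z)` is continuous on `SU(1,1)`. -/
lemma continuous_denom_inv_left (z : ℂ) : Continuous fun g : SU11 => denom (mat g⁻¹) z := by
  simp_rw [denom_inv_eq]
  exact continuous_mat00.sub ((Complex.continuous_conj.comp continuous_mat01).mul continuous_const)

/-- `g ↦ g⁻¹·z` is continuous on `SU(1,1)` for `z ∈ 𝔻`. -/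
lemma continuous_mobius_inv_left {z : ℂ} (hz : z ∈ ball (0 : ℂ) 1) :
    Continuous fun g : SU11 => mobius (mat g⁻¹) z := by
  simp_rw [mobius_inv_eq]
  exact (((Complex.continuous_conj.comp continuous_mat00).mul continuous_const).add
    continuous_mat01.neg).div (continuous_denom_inv_left z)
    (fun g => denom_inv_ne_zero g (ball_subset_closedBall hz))

/-- **`g ↦ (π_k(g) f)(z)` is continuous on `SU(1,1)`** for `z ∈ 𝔻` and `f` continuous on `𝔻`. -/
theorem continuous_act_left (k : ℕ) (f : ℂ → ℂ) (hf : ContinuousOn f (ball 0 1)) {z : ℂ}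
    (hz : z ∈ ball (0 : ℂ) 1) : Continuous fun g : SU11 => act k g f z := by
  unfold act
  refine (((continuous_denom_inv_left z).inv₀
    (fun g => denom_inv_ne_zero g (ball_subset_closedBall hz))).pow k).mul ?_
  exact hf.comp_continuous (continuous_mobius_inv_left hz) (fun g => mobius_mem_ball g⁻¹ hz)

/-! ### Stability of `A_k` and Cauchy–Schwarz -/

/-- **`A_k` is stable under `π_k(g)`**: for holomorphic `f ∈ A_k`, `|π_k(g) f|² (1 - |z|²)^{k-2}` is
integrable on the disc (unitarity `pairing_act_act` gives `⟨π_k(g) f, π_k(g) f⟩_k = ⟨f, f⟩_k`; a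
non-integrable integrand would force `⟨f, f⟩_k = 0`, hence `f = 0` on `𝔻` and `π_k(g) f = 0` on `𝔻`). -/
theorem integrableOn_act (k : ℕ) (hk : 2 ≤ k) (g : SU11) (f : ℂ → ℂ)
    (hf : DifferentiableOn ℂ f (ball 0 1))
    (hint : IntegrableOn (fun w => ‖f w‖ ^ 2 * (1 - ‖w‖ ^ 2) ^ (k - 2)) (ball (0 : ℂ) 1)) :
    IntegrableOn (fun w => ‖act k g f w‖ ^ 2 * (1 - ‖w‖ ^ 2) ^ (k - 2)) (ball (0 : ℂ) 1) := by
  by_contra hn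
  have h0 : ∫ w in ball (0 : ℂ) 1, ‖act k g f w‖ ^ 2 * (1 - ‖w‖ ^ 2) ^ (k - 2) = 0 :=
    integral_undef hn
  have h1 : pairing k f f = 0 := by
    rw [← pairing_act_act k hk g f f, pairing_self_eq, h0, Complex.ofReal_zero]
  have hzero : ∀ z ∈ ball (0 : ℂ) 1, f z = 0 := fun z hz =>
    eq_zero_of_pairing_self_eq_zero k f hf hint h1 hz
  apply hn
  refine (integrableOn_zero (μ := volume) (s := ball (0 : ℂ) 1)).congr_fun ?_ measurableSet_ball
  intro w hw
  have : act k g f w = 0 := by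
    unfold act
    rw [hzero _ (mobius_mem_ball g⁻¹ hw), mul_zero]
  simp [this]

/-- **Cauchy–Schwarz for the matrix coefficients**: `|⟨π_k(g) f, h⟩_k|² ≤ ⟨f, f⟩_k ⟨h, h⟩_k` for
holomorphic `f ∈ A_k` and `h ∈ A_k` (continuous on `𝔻`). -/
theorem norm_pairing_act_sq_le (k : ℕ) (hk : 2 ≤ k) (g : SU11) (f h : ℂ → ℂ)
    (hf : DifferentiableOn ℂ f (ball 0 1))
    (hfint : IntegrableOn (fun w => ‖f w‖ ^ 2 * (1 - ‖w‖ ^ 2) ^ (k - 2)) (ball (0 : ℂ) 1))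
    (hh : ContinuousOn h (ball 0 1))
    (hhint : IntegrableOn (fun w => ‖h w‖ ^ 2 * (1 - ‖w‖ ^ 2) ^ (k - 2)) (ball (0 : ℂ) 1)) :
    ‖pairing k (act k g f) h‖ ^ 2 ≤ (pairing k f f).re * (pairing k h h).re := by
  have := norm_pairing_sq_le k (continuousOn_act k g f hf.continuousOn) hh
    (integrableOn_act k hk g f hf hfint) hhint
  rwa [pairing_act_act k hk g f f] at this

/-- The same bound in the form `|⟨π_k(g) f, h⟩_k| ≤ √(⟨f, f⟩_k ⟨h, h⟩_k)`. -/
theorem norm_pairing_act_le (k : ℕ) (hk : 2 ≤ k) (g : SU11) (f h : ℂ → ℂ)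
    (hf : DifferentiableOn ℂ f (ball 0 1))
    (hfint : IntegrableOn (fun w => ‖f w‖ ^ 2 * (1 - ‖w‖ ^ 2) ^ (k - 2)) (ball (0 : ℂ) 1))
    (hh : ContinuousOn h (ball 0 1))
    (hhint : IntegrableOn (fun w => ‖h w‖ ^ 2 * (1 - ‖w‖ ^ 2) ^ (k - 2)) (ball (0 : ℂ) 1)) :
    ‖pairing k (act k g f) h‖ ≤ Real.sqrt ((pairing k f f).re * (pairing k h h).re) := by
  rw [Real.le_sqrt (norm_nonneg _)
    (mul_nonneg (pairing_self_nonneg k f).1 (pairing_self_nonneg k h).1)]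
  exact norm_pairing_act_sq_le k hk g f h hf hfint hh hhint

/-- The integrability of the cross term `(π_k(g) f) h̄ (1 - |z|²)^{k-2}` on the disc. -/
theorem integrableOn_act_mul_conj (k : ℕ) (hk : 2 ≤ k) (g : SU11) (f h : ℂ → ℂ)
    (hf : DifferentiableOn ℂ f (ball 0 1))
    (hfint : IntegrableOn (fun w => ‖f w‖ ^ 2 * (1 - ‖w‖ ^ 2) ^ (k - 2)) (ball (0 : ℂ) 1))
    (hh : ContinuousOn h (ball 0 1))
    (hhint : IntegrableOn (fun w => ‖h w‖ ^ 2 * (1 - ‖w‖ ^ 2) ^ (k - 2)) (ball (0 : ℂ) 1)) :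
    IntegrableOn (fun z => act k g f z * (starRingEnd ℂ) (h z) * (((1 - ‖z‖ ^ 2) ^ (k - 2) : ℝ) : ℂ))
      (ball (0 : ℂ) 1) :=
  integrableOn_mul_conj k (continuousOn_act k g f hf.continuousOn) hh
    (integrableOn_act k hk g f hf hfint) hhint

end Summit.Ventures.HodgeRepro2.T5BergmanActStable
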